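import Literature.Combinatorics.Sahi2008.Indicators
import HarnessLib

/-!
# `NoHeavyLowerTail` (stmt-CriticalPhenomena-4575) — chord superlinearity of `E₃` along some coordinate (FBP) reduces
# Sahi's `C₃` on Boolean cubes with product weights to a one-coordinate statement

Support file of the `|A| = 5` / master-family surge, seat `prim-l12-p5`, `--supports stmt-CriticalPhenomena-4575`.
STATEMENT-FIRST file: one `@[conjecture]` definition (the census target `ChordSuperlinear`, an obligation of THIS
programme), two data definitions (`cubeWeight`, `cubeSection`) and the PROVED reduction
`sahiPositive_three_of_chordSuperlinear` to the tree's `Literature.Combinatorics.Sahi2008.SahiPositive _ 3`; nothing is asserted.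

## The statement (P5-REPORT §3d; ttrl census requests.jsonl l.511 + addendum `p5-fbp-chord-superlinearity`)

On the cube `{0,1}^k = Fin k → Bool` with the product weight `w_q(x) = Π_i (q_i if x_i else 1 − q_i)`, for a triple
`f = (f₀,f₁,f₂)` of nonnegative monotone functions and a coordinate `j`, the SECTIONS `f ∘ ins_j^b` (`b = false/true`,
`ins_j^b = Fin.insertNth j b`) live on `Fin (k−1) → Bool` with weight `w_{q ∘ j.succAbove}`, and `p ↦ E₃` along coordinate
`j` is a cubic whose values at `p = 0, 1` are the `E₃` of the two sections.  FBP(j) says the cubic lies above its chord at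
`p = q_j`:
    `E₃^{w_q}(f) ≥ (1 − q_j)·E₃(f ∘ ins_j^{false}) + q_j·E₃(f ∘ ins_j^{true})`,
equivalently (law of total `E₃`, tree `…SahiTotalE3`) the first per-bit term of the martingale decomposition at `j` is
`≥ 0`, equivalently `(1−q_j)(3β₁ − 2β₀ − β₃) + q_j(3β₂ − β₀ − 2β₃) ≥ 0` in the Bernstein coefficients of
`…SahiE3TwoLevel`.  `ChordSuperlinear k` := for every `q ∈ [0,1]^{k+1}` and every triple of monotone INDICATOR functions on
`Fin (k+1) → Bool` SOME coordinate satisfies FBP (indicator form = exactly what the census tests; the function form would be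
stronger, since a common good coordinate for a mixture is not implied).  CENSUS (seat, exact): k = 2,3 exhaustive (448 + 15 400
(triple, q)), k = 4 sampled 51 000, symmetric thresholds k ≤ 14 (42 581), cyclically symmetric triples k ≤ 8 (5 712),
percolation group-separation triples on 270 weighted graphs with ≤ 10 edges: 0 failures; the "every coordinate" and all
averaged versions are FALSE (witnesses in the report).

## The reduction (proved here)

`sahiPositive_three_of_chordSuperlinear : (∀ k, ChordSuperlinear k) → ∀ k q, q ∈ [0,1]^k → SahiPositive (cubeWeight q) 3`
(`E₃^{w_q}(f) ≥ 0` for all nonnegative monotone triples) — by induction on `k` over INDICATOR triples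
(`sahiE_three_nonneg_of_chordSuperlinear`) and then the tree's layer cake `sahiPositive_iff_indicators`: the sections of a nonnegative monotone triple are
nonnegative monotone (`Fin.insertNth` is monotone in the tuple), the base `k = 0` is the one-point space where `E₃ ≡ 0`,
and `E₃ ≥ (1−q_j)E₃⁰ + q_jE₃¹ ≥ 0`.  `SahiPositive (cubeWeight q) 3` for all `k, q` is Sahi's `C₃` for product measures on finite Boolean lattices
in the `sahiE` vocabulary (indicator triples are the case `f_i ∈ {0,1}`; by the tree's layer cake
`Literature.Combinatorics.Sahi2008.sahiPositive_iff_indicators` the two are equivalent), i.e. Kahn's Conjecture 5 up to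
the dictionary `prodBernoulli ↔ w_q` (not re-proved here).
-/

namespace Summit.CriticalPhenomena.PercolationContinuityZ3.Theorems

namespace SahiChordSuperlinear

open Finset Literature.Combinatorics.Sahi2008

/-- The product weight `w_q(x) = Π_i (q_i if x_i else 1 − q_i)` on the cube `Fin k → Bool`. [this file] -/
def cubeWeight {k : ℕ} (q : Fin k → ℝ) (x : Fin k → Bool) : ℝ :=
  ∏ i, (if x i then q i else 1 - q i)

/-- The section of `f : (Fin (k+1) → Bool) → ℝ` along coordinate `j` at the value `b`, a function on `Fin k → Bool`
(`x ↦ f (Fin.insertNth j b x)`). [this file] -/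
def cubeSection {k : ℕ} (j : Fin (k + 1)) (b : Bool) (f : (Fin (k + 1) → Bool) → ℝ) : (Fin k → Bool) → ℝ :=
  fun x => f (Fin.insertNth (α := fun _ => Bool) j b x)

/-- **FBP / chord superlinearity along SOME coordinate** on the cube `Fin (k+1) → Bool`: for every product weight and
every triple of monotone INDICATOR functions (`{0,1}`-valued, i.e. indicators of up-sets) there is a coordinate `j` with
`E₃(f) ≥ (1 − q_j)·E₃(section at false) + q_j·E₃(section at true)`.  A conjecture OF THIS PROGRAMME (seat prim-l12-p5,
2026-08-19; census-validated, see the module docstring and run/shared/lean/ttrl/requests.jsonl `p5-fbp-chord-superlinearity`);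
NOT asserted — an obligation node: a proof for all `k` gives `SahiPositive (cubeWeight q) 3` for every cube
(`sahiPositive_three_of_chordSuperlinear`), one counterexample refutes it by name. [this file] [status: open] -/
@[conjecture] def ChordSuperlinear (k : ℕ) : Prop :=
  ∀ (q : Fin (k + 1) → ℝ), (∀ i, 0 ≤ q i ∧ q i ≤ 1) →
    ∀ f : Fin 3 → (Fin (k + 1) → Bool) → ℝ, (∀ i x, f i x = 0 ∨ f i x = 1) → (∀ i, Monotone (f i)) →
      ∃ j : Fin (k + 1),
        (1 - q j) * sahiE (cubeWeight (fun i => q (j.succAbove i))) 3 (fun i => cubeSection j false (f i))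
          + q j * sahiE (cubeWeight (fun i => q (j.succAbove i))) 3 (fun i => cubeSection j true (f i))
        ≤ sahiE (cubeWeight q) 3 f

/-- `Fin.insertNth j b` is monotone in the tuple, so sections of monotone functions are monotone. [folklore] -/
theorem monotone_cubeSection {k : ℕ} (j : Fin (k + 1)) (b : Bool) {f : (Fin (k + 1) → Bool) → ℝ}
    (hf : Monotone f) : Monotone (cubeSection j b f) := by
  intro x y hxy
  apply hf
  rw [Fin.insertNth_le_iff]
  refine ⟨?_, fun i => ?_⟩
  · simp [Fin.insertNth_apply_same]
  · simpa [Fin.insertNth_apply_succAbove] using hxy i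

/-- Base case: on the one-point cube `Fin 0 → Bool`, `E₃ ≡ 0` (the weight of the unique point is the empty product `1`).
[folklore] -/
theorem sahiE_three_fin_zero (q : Fin 0 → ℝ) (f : Fin 3 → (Fin 0 → Bool) → ℝ) :
    sahiE (cubeWeight q) 3 f = 0 := by
  rw [sahiE_three_apply]
  simp only [ex, cubeWeight, Finset.univ_eq_empty, Finset.prod_empty, one_mul, Pi.mul_apply]
  simp only [Fintype.sum_unique]
  ring

/-- Sections of `{0,1}`-valued functions are `{0,1}`-valued. [folklore] -/
theorem ind_cubeSection {k : ℕ} (j : Fin (k + 1)) (b : Bool) {f : (Fin (k + 1) → Bool) → ℝ}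
    (hf : ∀ x, f x = 0 ∨ f x = 1) : ∀ x, cubeSection j b f x = 0 ∨ cubeSection j b f x = 1 :=
  fun _ => hf _

/-- **Reduction, indicator form**: chord superlinearity along some coordinate in every dimension implies
`E₃^{w_q}(f₀,f₁,f₂) ≥ 0` for every product weight `q ∈ [0,1]^k` and every triple of monotone indicator functions on
`Fin k → Bool` (induction on `k`: sections inherit the hypotheses, the base is the one-point cube, and
`E₃ ≥ (1−q_j)E₃⁰ + q_jE₃¹ ≥ 0`). [this file] -/
theorem sahiE_three_nonneg_of_chordSuperlinear (H : ∀ k, ChordSuperlinear k) :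
    ∀ k (q : Fin k → ℝ), (∀ i, 0 ≤ q i ∧ q i ≤ 1) →
      ∀ f : Fin 3 → (Fin k → Bool) → ℝ, (∀ i x, f i x = 0 ∨ f i x = 1) → (∀ i, Monotone (f i)) →
        0 ≤ sahiE (cubeWeight q) 3 f := by
  intro k
  induction k with
  | zero =>
    intro q _ f _ _
    rw [sahiE_three_fin_zero]
  | succ k ih =>
    intro q hq f hf hmono
    obtain ⟨j, hj⟩ := H k q hq f hf hmono
    have hq' : ∀ i, 0 ≤ q (j.succAbove i) ∧ q (j.succAbove i) ≤ 1 := fun i => hq _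
    have h0 := ih (fun i => q (j.succAbove i)) hq' (fun i => cubeSection j false (f i))
      (fun i => ind_cubeSection j false (hf i)) (fun i => monotone_cubeSection j false (hmono i))
    have h1 := ih (fun i => q (j.succAbove i)) hq' (fun i => cubeSection j true (f i))
      (fun i => ind_cubeSection j true (hf i)) (fun i => monotone_cubeSection j true (hmono i))
    have hqj := hq j
    nlinarith [hj, h0, h1, hqj.1, hqj.2, mul_nonneg (sub_nonneg.2 hqj.2) h0, mul_nonneg hqj.1 h1]

/-- **Reduction to Sahi's `C₃` on cubes**: chord superlinearity along some coordinate, for every dimension, implies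
order-3 Sahi positivity `Literature.Combinatorics.Sahi2008.SahiPositive (cubeWeight q) 3` (all NONNEGATIVE MONOTONE
triples, by the tree's layer cake `sahiPositive_iff_indicators`) on every Boolean cube `Fin k → Bool` with every product
weight `q ∈ [0,1]^k` — the product-measure case of Sahi's Conjecture 5 / Kahn's Conjecture 5 in the `sahiE` vocabulary.
[this file] -/
theorem sahiPositive_three_of_chordSuperlinear (H : ∀ k, ChordSuperlinear k) (k : ℕ) (q : Fin k → ℝ)
    (hq : ∀ i, 0 ≤ q i ∧ q i ≤ 1) : SahiPositive (cubeWeight q) 3 := by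
  classical
  rw [sahiPositive_iff_indicators]
  intro U hU
  exact sahiE_three_nonneg_of_chordSuperlinear H k q hq (fun i => setInd (U i))
    (fun i x => by unfold setInd; split_ifs <;> simp) (fun i => monotone_setInd (hU i))

end SahiChordSuperlinear

end Summit.CriticalPhenomena.PercolationContinuityZ3.Theorems
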